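import Summits.AtomisticToContinuum.FouriersLaw.Theses.EmbeddedDrudeMourre
import Summits.AtomisticToContinuum.FouriersLaw.Theses.FourierGreenKubo
import Literature.MathematicalPhysics.KineticTheory.InfiniteChainAbelWitness
import HarnessLib

/-!
# `GreenKuboContinuation` (stmt-AtomisticToContinuum-12597) from `FourierGreenKubo` (stmt-AtomisticToContinuum-0703)

The crux `EmbeddedDrudeMourre.GreenKuboContinuation` (propagation of Abelian Green–Kubo witnesses of
`pinnedChain ω₂ lam β γ` from a corner `(0, T₀)` to every `T > 0`) is implied by the sibling route's
item `FourierGreenKubo.FourierGreenKubo` (stmt-0703: at every `T > 0` a Gibbs state with a preserving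
infinite-volume dynamics whose summed current autocorrelation is absolutely convergent, `L¹(0,∞)`, with
`κ_GK > 0`): an `L¹` Green–Kubo pair is an Abelian witness with `κ = κ_GK` by dominated convergence
(`InfiniteChainDynamics.HasGreenKubo.tendsto_abel`, Literature), at every temperature, so the corner
hypothesis is not even used. This is the certified form of the planner's remark "implied by
FourierGreenKubo's 0703" in the crux docstring and of `greenKuboContinuation_of_fourierGreenKubo` in the
crux workfile `Cruxes/GreenKuboContinuation/Disproof.lean` §4b (a workfile, not importable); it records
formally that **stmt-12597 ≤ stmt-0703**: a proof of `FourierGreenKubo` closes this crux with the term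
`greenKuboContinuation_of_fourierGreenKubo`.

Also recorded: the corner-free sufficient condition with the witness clause spelled verbatim
(`greenKuboContinuation_of_abelWitnessAllT`), for provers reaching all-`T` Abelian Green–Kubo by any
other engine; and the converse modulo the route's own corner items
(`abelWitnessAllT_of_greenKuboContinuation`: `DrudeDissolution → AbelOfSpectralDensity →
GreenKuboContinuation →` all-`T` witnesses, Steps 1–2 of the route's `closes` isolated) — modulo the
corner the crux IS the conjunct's all-`T` Abelian Green–Kubo content.
-/

namespace Summit.AtomisticToContinuum.FouriersLaw.Theorems.GreenKuboContinuation

open Filter Topology MeasureTheory Set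
open Literature.MathematicalPhysics.KineticTheory.HeatConduction

/-- **All-`T` Abelian Green–Kubo from `FourierGreenKubo`.** Under stmt-0703, at every `T > 0` the
pinned chain has an Abelian Green–Kubo witness (the witness clause of `GreenKuboContinuation`,
verbatim): the `L¹` Green–Kubo pair `(μ, D)` of 0703 with `κ = κ_GK(T) = T⁻² ∫₀^∞ C_T > 0`, the Abel
limit `T⁻² ∫₀^∞ e^{-νt} C_T(t) dt → κ_GK(T)` holding by dominated convergence
(`InfiniteChainDynamics.HasGreenKubo.tendsto_abel`). -/
theorem abelWitnessAllT_of_fourierGreenKubo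
    (h : Summit.AtomisticToContinuum.FouriersLaw.Theses.FourierGreenKubo.FourierGreenKubo) :
    ∀ ω₂ lam β γ : ℝ, 0 < ω₂ → 0 < lam → 0 < β → 0 < γ → ∀ T : ℝ, 0 < T →
      ∃ (μT : Measure ChainConfig) (D : InfiniteChainDynamics (pinnedChain ω₂ lam β γ)) (κ : ℝ),
        (pinnedChain ω₂ lam β γ).IsChainGibbsMeasure T μT ∧ D.PreservesMeasure μT ∧
        (∀ t : ℝ, D.HasAbsConvergentCorrelation μT t) ∧ 0 < κ ∧
        Tendsto (fun ν : ℝ => (T ^ 2)⁻¹ * ∫ t in Ioi (0 : ℝ),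
            Real.exp (-(ν * t)) * D.currentCorrelation μT t) (𝓝[>] (0 : ℝ)) (𝓝 κ) := by
  intro ω₂ lam β γ hω hl hβ hγ T hT
  obtain ⟨μ, hG, D, hP, hGK⟩ := h ω₂ lam β γ hω hl hβ hγ T hT
  exact ⟨μ, D, D.greenKuboConductivity μ T, hG, hP, hGK.1, hGK.pos, hGK.tendsto_abel⟩

/-- **Corner-free sufficient condition.** If Abelian Green–Kubo witnesses exist at EVERY `T > 0`
(witness clause verbatim), the crux `GreenKuboContinuation` holds — its corner hypothesis is simply
discarded. (The honest prover target absent a continuation mechanism; cf. the crux docstring.) -/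
theorem greenKuboContinuation_of_abelWitnessAllT
    (h : ∀ ω₂ lam β γ : ℝ, 0 < ω₂ → 0 < lam → 0 < β → 0 < γ → ∀ T : ℝ, 0 < T →
      ∃ (μT : Measure ChainConfig) (D : InfiniteChainDynamics (pinnedChain ω₂ lam β γ)) (κ : ℝ),
        (pinnedChain ω₂ lam β γ).IsChainGibbsMeasure T μT ∧ D.PreservesMeasure μT ∧
        (∀ t : ℝ, D.HasAbsConvergentCorrelation μT t) ∧ 0 < κ ∧
        Tendsto (fun ν : ℝ => (T ^ 2)⁻¹ * ∫ t in Ioi (0 : ℝ),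
            Real.exp (-(ν * t)) * D.currentCorrelation μT t) (𝓝[>] (0 : ℝ)) (𝓝 κ)) :
    Summit.AtomisticToContinuum.FouriersLaw.Theses.EmbeddedDrudeMourre.GreenKuboContinuation := by
  intro ω₂ lam β γ hω hl hβ hγ _T₀ _hT₀ _hcorner T hT
  exact h ω₂ lam β γ hω hl hβ hγ T hT

/-- **stmt-12597 ≤ stmt-0703.** `FourierGreenKubo.FourierGreenKubo` (Green–Kubo with `C_T ∈ L¹` at
every `T > 0` for the infinite pinned anharmonic chain) implies the crux
`EmbeddedDrudeMourre.GreenKuboContinuation`; a prover of stmt-0703 closes stmt-12597 with this term. -/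
theorem greenKuboContinuation_of_fourierGreenKubo :
    Summit.AtomisticToContinuum.FouriersLaw.Theses.FourierGreenKubo.FourierGreenKubo →
      Summit.AtomisticToContinuum.FouriersLaw.Theses.EmbeddedDrudeMourre.GreenKuboContinuation :=
  fun h => greenKuboContinuation_of_abelWitnessAllT (abelWitnessAllT_of_fourierGreenKubo h)

/-- **Converse direction modulo the route's own corner items** (Steps 1–2 of the route's `closes`,
isolated): the dissolved Drude atom `DrudeDissolution` (stmt-12593's export) and the Poisson-kernel
lemma `AbelOfSpectralDensity` (stmt-12598, closed) give Abelian witnesses on a corner `(0, T₀)` with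
`κ = T⁻² π g_T(0)`, and the crux propagates them to every `T > 0`. Together with
`greenKuboContinuation_of_abelWitnessAllT`: MODULO THE CORNER the crux IS all-`T` Abelian Green–Kubo
for the pinned chain — the propagation form buys bookkeeping, not strength. -/
theorem abelWitnessAllT_of_greenKuboContinuation
    (hDD : Summit.AtomisticToContinuum.FouriersLaw.Theses.EmbeddedDrudeMourre.DrudeDissolution)
    (hA : Summit.AtomisticToContinuum.FouriersLaw.Theses.EmbeddedDrudeMourre.AbelOfSpectralDensity)
    (hC : Summit.AtomisticToContinuum.FouriersLaw.Theses.EmbeddedDrudeMourre.GreenKuboContinuation) :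
    ∀ ω₂ lam β γ : ℝ, 0 < ω₂ → 0 < lam → 0 < β → 0 < γ → ∀ T : ℝ, 0 < T →
      ∃ (μT : Measure ChainConfig) (D : InfiniteChainDynamics (pinnedChain ω₂ lam β γ)) (κ : ℝ),
        (pinnedChain ω₂ lam β γ).IsChainGibbsMeasure T μT ∧ D.PreservesMeasure μT ∧
        (∀ t : ℝ, D.HasAbsConvergentCorrelation μT t) ∧ 0 < κ ∧
        Tendsto (fun ν : ℝ => (T ^ 2)⁻¹ * ∫ t in Ioi (0 : ℝ),
            Real.exp (-(ν * t)) * D.currentCorrelation μT t) (𝓝[>] (0 : ℝ)) (𝓝 κ) := by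
  intro ω₂ lam β γ hω hl hβ hγ
  obtain ⟨T₀, hT₀, hdiss⟩ := hDD ω₂ lam β γ hω hl hβ hγ
  refine hC ω₂ lam β γ hω hl hβ hγ T₀ hT₀ fun T hT hTlt => ?_
  obtain ⟨μT, D, hG, hP, hAC, σ, hσ, hCσ, δ, g, hδ, hg, hg0, hgpos, hac⟩ := hdiss T hT hTlt
  exact ⟨μT, D, (T ^ 2)⁻¹ * (Real.pi * g 0), hG, hP, hAC,
    mul_pos (inv_pos.mpr (pow_pos hT 2)) (mul_pos Real.pi_pos hgpos),
    (hA σ (D.currentCorrelation μT) δ g hσ hδ hCσ hg hg0 hac).const_mul ((T ^ 2)⁻¹)⟩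

end Summit.AtomisticToContinuum.FouriersLaw.Theorems.GreenKuboContinuation
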